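import Literature.Algebra.EuclideanLattices.GapCVPCoNPSample
import HarnessLib

/-!
# `GapCVP_γ ∈ NP` for `γ ≥ 1`: the verifier "`‖z B − t‖ ≤ d`" in `P`, discharge of `gapCVP_mem_promiseNP`

Topic `Algebra/EuclideanLattices` (family `pqc`), sibling proof file of `LatticeGapCVPNPcoNP.lean`
(D-0014: the named fact `Literature.Algebra.EuclideanLattices.gapCVP_mem_promiseNP : Prop` stays a
`def` there and is discharged here as `gapCVP_mem_promiseNP_holds`), and the `GapCVP` twin of
`GapSVPVerifier.lean` (`gapSVP_mem_promiseNP_holds`), whose bricks, decoding lemmas and size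
estimates it reuses. This is the NP leaf of the `GapCVP` half of Aharonov–Regev 2005, Thm. 1.1
(`gapCVP_sqrt_mem_promiseNP_inter_promiseCoNP` of `LatticeComplexity.lean`, the second conjunct of
the barrier fact `Literature.Barriers.PneNP.LatticeGapCoNP`); after this file BOTH conjuncts of
that fact are conditional on the coNP part of Thm. 1.1 alone
(`gapSVP_and_gapCVP_sqrt_mem_of_coNP_part`), i.e. — with `GapCVPCoNPSample.lean` — on the two
named facts `FarCert.verifier_mem_P` and `FarCert.psd_cert_exists`
(`gapSVP_and_gapCVP_sqrt_mem_of_psd`).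

## The printed statement

D. Aharonov, O. Regev, *Lattice problems in NP ∩ coNP*, J. ACM 52 (2005), p. 2: "We note that
containment in NP is trivial, and the difficult part is showing the containment in coNP";
O. Regev, in Nguyễn–Vallée (eds.), *The LLL Algorithm* (2010), Ch. 15, p. 477: "a witness for
`dist(v, L(B)) ≤ d` is simply a vector `u ∈ L(B)` such that `‖v − u‖ ≤ d`".

## The Lean proof (machine level: Mathlib's `TM2` through the tree's `FP` algebra)

* **The verifier** `gapCVPVerifFn ∈ FP` is the matrix loop of `IntVectorBricks.lean` run on the
  AUGMENTED data: the `(n+1) × n` row-major entry list `[t; B]` (the target's entry codes followed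
  by the basis', both read off the instance code and concatenated) and the coefficient string
  `⟨dpEnc (−1), y⟩` (the constant `−1` prepended to the witness), for `n + 1` rounds
  (`matLoopFn_spec_rounds`, the loop's specification with the round counter decoupled from the
  row length). Its accumulator is therefore `v = −t + z B` for the TOTALLY decoded witness
  `zᵢ = ival (elemOf y i)` (`ival_matAcc_aug`); then `S = ∑ⱼ vⱼ²` (`sqLoopFn`) and the machine
  accepts iff `den(d)² S ≤ num(d)²`, i.e. iff `‖z B − t‖ ≤ |d|` (`gapCVPVerifFn_encode`: the exact
  value on the code of ANY instance paired with ANY string). No positivity test and no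
  dimension-`0` branch are needed (for `n = 0` the empty witness is accepted, and rightly so).
* **Soundness** is automatic: an accepted pair exhibits the lattice vector `z B` at distance
  `≤ d ≤ γ(n) d < dist(t, L(B))` from `t` on a NO instance (`not_mem_gapCVPVerifLang_of_no`).
* **Completeness**: a closest lattice vector `u = z B` (`L(B)` is closed and `ℝⁿ` proper) has
  `‖u − t‖ = dist(t, L(B)) ≤ d` and `‖u‖ ≤ 2‖t‖` (compare with `0 ∈ L(B)`), so `|uⱼ| ≤ 2 n T`,
  `T = max |tₖ|`, and Cramer's rule with Hadamard's bound (`natAbs_coeff_le` of the `GapSVP` file)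
  gives `|zᵢ| ≤ n! Kⁿ`, `K = 2 n max(M, T)`, whence the canonical witness has length
  `≤ 24 (|x| + 1)³` (`exists_short_witness_of_yes_cvp`).
* The `NP` language is `{x | ∃ y, |y| ≤ 24 (|x| + 1)³ ∧ ⟨x, y⟩ accepted}` (`NP = ∃ᵖ P` by definition).

## References

* D. Aharonov, O. Regev, *Lattice problems in NP ∩ coNP*, J. ACM 52 (2005) 749–765, §1 p. 2, Thm. 1.1.
* O. Regev, *On the complexity of lattice problems with polynomial approximation factors*, in
  *The LLL Algorithm*, Springer 2010, Ch. 15, p. 477.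
* D. Micciancio, S. Goldwasser, *Complexity of Lattice Problems*, Kluwer 2002, Ch. 1 §1.2–1.3
  (input size; `GapCVP`; integral closest vectors and Cramer's rule).
* S. Arora, B. Barak, *Computational Complexity: A Modern Approach*, CUP 2009, Def. 2.1, §1.3.
-/

noncomputable section

open Computability Literature.Computability.Complexity Literature.Computability.Complexity.Nondeterministic
open Literature.Computability.Complexity.Brick OracleCompose PRelSigPi Polynomial Metric

namespace Literature.Algebra.EuclideanLattices

open GMSS

/-! ### The matrix loop with an independent round counter -/

/-- **The matrix loop for `m` rounds over rows of length `n`**: from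
`⟨⟨ents, ⟨zs, n⟩⟩, ⟨m, ⟨1⁰, ⟨1⁰, body 0ⁿ⟩⟩⟩⟩` with `n ≤ |ents|` (and, automatically, `m` within the
round budget `|⟨ents, ⟨zs, n⟩⟩|`) it ends with the list code of `acc_m`, the vector `z E` for the
`m × n` row-major entry list `E` — `matLoopFn_spec` of `IntVectorBricks.lean` is the case `m = n`.
[cite: KnuthTAOCP2, §4.6.4] -/
theorem matLoopFn_spec_rounds (ents zs : List Bool) (n m : ℕ) (hn : n ≤ ents.length)
    (hm : m ≤ (boolPair ents (boolPair zs (encodeNat n))).length) :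
    matLoopFn (boolPair (boolPair ents (boolPair zs (encodeNat n)))
        (boolPair (encodeNat m) (boolPair [] (boolPair [] (body (List.replicate n [])))))) =
      boolPair (boolPair ents (boolPair zs (encodeNat n))) (boolPair []
        (boolPair (List.replicate m true) (boolPair (List.replicate (m * n) true) (body (matAcc ents zs n m))))) := by
  have hx : fstF (boolPair (boolPair ents (boolPair zs (encodeNat n)))
      (boolPair (encodeNat m) (boolPair [] (boolPair [] (body (List.replicate n [])))))) =
      boolPair ents (boolPair zs (encodeNat n)) := by simp [fstF]
  have hrounds : m ≤ X.eval (boolPair ents (boolPair zs (encodeNat n))).length := by rwa [eval_X]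
  rw [matLoopFn, hx, iterate_loopStep matBody _ m _ _ hrounds,
    loopModel_eq_iterate (g := matStep ents zs (encodeNat n)) (fun cnt s => matBody_apply ents zs _ cnt s),
    iterate_matStep ents zs n hn m]

/-! ### Projections of the verifier's input `⟨x, y⟩`, `x = ⟨⟨nc, ⟨⟨hm, entsB⟩, ⟨hu, entsT⟩⟩⟩, ⟨⟨sg, num⟩, den⟩⟩`

The dimension header `nc`, `|num d|`, `den d` and the unary dimension sit where they sit in a
`GapSVP` code, so `vNcFn`, `vNumFn`, `vDenFn`, `vOnesFn`, `vNum2Fn`, `vDen2Fn` of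
`GapSVPVerifier.lean` are reused. -/

/-- The row-major list of entry codes of `B`. [folklore] -/
def cEntsBFn : List Bool → List Bool := sndF ∘ fstF ∘ sndF ∘ fstF ∘ fstF
/-- The list of entry codes of the target `t`. [folklore] -/
def cEntsTFn : List Bool → List Bool := sndF ∘ sndF ∘ sndF ∘ fstF ∘ fstF
/-- The augmented `(n+1) × n` entry list `[t; B]`. [folklore] -/
def cEntsFn (w : List Bool) : List Bool := cEntsTFn w ++ cEntsBFn w
/-- The augmented coefficient string `⟨dpEnc (−1), y⟩`. [folklore] -/
def cZsFn : List Bool → List Bool := fanoutFn (fun _ => dpEnc (-1)) sndF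
/-- The round counter `n + 1` in binary. [folklore] -/
def cCntFn : List Bool → List Bool := addFn ∘ fanoutFn vNcFn (fun _ => encodeNat 1)
/-- The record handed to the matrix loop: `⟨⟨[t; B], ⟨⟨−1, y⟩, nc⟩⟩, ⟨n+1, ⟨1⁰, ⟨1⁰, body 0ⁿ⟩⟩⟩⟩`.
[folklore] -/
def cZ2Fn : List Bool → List Bool :=
  fanoutFn (fanoutFn cEntsFn (fanoutFn cZsFn vNcFn))
    (fanoutFn cCntFn (fanoutFn (fun _ => []) (fanoutFn (fun _ => []) (zerosFn ∘ vOnesFn))))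
/-- The list code of the vector `v = z B − t`. [folklore] -/
def cVecFn : List Bool → List Bool := sndPow 3 ∘ matLoopFn ∘ cZ2Fn
/-- The record handed to the squares loop: `⟨v, ⟨nc, ⟨1⁰, ε⟩⟩⟩`. [folklore] -/
def cZ3Fn : List Bool → List Bool := fanoutFn cVecFn (fanoutFn vNcFn (fanoutFn (fun _ => []) fun _ => []))
/-- The difference pair `S = ∑ⱼ vⱼ²`. [folklore] -/
def cSFn : List Bool → List Bool := sndPow 2 ∘ sqLoopFn ∘ cZ3Fn
/-- `num² + den² · S⁻` (with `S = ⟨S⁺, S⁻⟩`). [folklore] -/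
def cLhsFn : List Bool → List Bool := addFn ∘ fanoutFn vNum2Fn (prodFn ∘ fanoutFn vDen2Fn (sndF ∘ cSFn))
/-- `den² · S⁺`. [folklore] -/
def cRhsFn : List Bool → List Bool := prodFn ∘ fanoutFn vDen2Fn (fstF ∘ cSFn)

/-- **The verifier**: accept iff not `num² + den² S⁻ < den² S⁺`, i.e. iff `den² ‖z B − t‖² ≤ num²`.
[cite: AharonovRegev2005, §1 p. 2 ("containment in NP is trivial")] -/
def gapCVPVerifFn : List Bool → List Bool := notFn (ltFn ∘ fanoutFn cLhsFn cRhsFn)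

/-! ### Polynomial time -/

/-- `cEntsBFn ∈ FP`. [folklore] -/
theorem cEntsBFn_mem_FP : cEntsBFn ∈ FP :=
  comp_mem_FP sndF_mem_FP (comp_mem_FP fstF_mem_FP (comp_mem_FP sndF_mem_FP (comp_mem_FP fstF_mem_FP fstF_mem_FP)))
/-- `cEntsTFn ∈ FP`. [folklore] -/
theorem cEntsTFn_mem_FP : cEntsTFn ∈ FP :=
  comp_mem_FP sndF_mem_FP (comp_mem_FP sndF_mem_FP (comp_mem_FP sndF_mem_FP (comp_mem_FP fstF_mem_FP fstF_mem_FP)))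
/-- `cEntsFn ∈ FP`. [folklore] -/
theorem cEntsFn_mem_FP : cEntsFn ∈ FP := append_mem_FP cEntsTFn_mem_FP cEntsBFn_mem_FP
/-- `cZsFn ∈ FP`. [folklore] -/
theorem cZsFn_mem_FP : cZsFn ∈ FP := fanoutFn_mem_FP (const_mem_FP _) sndF_mem_FP
/-- `cCntFn ∈ FP`. [folklore] -/
theorem cCntFn_mem_FP : cCntFn ∈ FP := comp_mem_FP addFn_mem_FP (fanoutFn_mem_FP vNcFn_mem_FP (const_mem_FP _))
/-- `cZ2Fn ∈ FP`. [folklore] -/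
theorem cZ2Fn_mem_FP : cZ2Fn ∈ FP :=
  fanoutFn_mem_FP (fanoutFn_mem_FP cEntsFn_mem_FP (fanoutFn_mem_FP cZsFn_mem_FP vNcFn_mem_FP))
    (fanoutFn_mem_FP cCntFn_mem_FP (fanoutFn_mem_FP (const_mem_FP _) (fanoutFn_mem_FP (const_mem_FP _)
      (comp_mem_FP zerosFn_mem_FP vOnesFn_mem_FP))))
/-- `cVecFn ∈ FP`. [folklore] -/
theorem cVecFn_mem_FP : cVecFn ∈ FP := comp_mem_FP (sndPow_mem_FP 3) (comp_mem_FP matLoopFn_mem_FP cZ2Fn_mem_FP)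
/-- `cZ3Fn ∈ FP`. [folklore] -/
theorem cZ3Fn_mem_FP : cZ3Fn ∈ FP :=
  fanoutFn_mem_FP cVecFn_mem_FP (fanoutFn_mem_FP vNcFn_mem_FP (fanoutFn_mem_FP (const_mem_FP _) (const_mem_FP _)))
/-- `cSFn ∈ FP`. [folklore] -/
theorem cSFn_mem_FP : cSFn ∈ FP := comp_mem_FP (sndPow_mem_FP 2) (comp_mem_FP sqLoopFn_mem_FP cZ3Fn_mem_FP)
/-- `cLhsFn ∈ FP`. [folklore] -/
theorem cLhsFn_mem_FP : cLhsFn ∈ FP :=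
  comp_mem_FP addFn_mem_FP (fanoutFn_mem_FP vNum2Fn_mem_FP (comp_mem_FP prodFn_mem_FP
    (fanoutFn_mem_FP vDen2Fn_mem_FP (comp_mem_FP sndF_mem_FP cSFn_mem_FP))))
/-- `cRhsFn ∈ FP`. [folklore] -/
theorem cRhsFn_mem_FP : cRhsFn ∈ FP :=
  comp_mem_FP prodFn_mem_FP (fanoutFn_mem_FP vDen2Fn_mem_FP (comp_mem_FP fstF_mem_FP cSFn_mem_FP))

/-- **The verifier is polynomial-time**: `gapCVPVerifFn ∈ FP`. [cite: AroraBarakCC2009, §1.3 (closure of polynomial time under composition and bounded loops)] -/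
theorem gapCVPVerifFn_mem_FP : gapCVPVerifFn ∈ FP :=
  notFn_mem_FP (comp_mem_FP ltFn_mem_FP (fanoutFn_mem_FP cLhsFn_mem_FP cRhsFn_mem_FP))

/-- The verifier answers one bit on every input. [folklore] -/
theorem oneBit_gapCVPVerifFn : OneBit gapCVPVerifFn := oneBit_notFn (oneBit_ltFn.comp _)

/-- Value of the verifier on every input. [folklore] -/
theorem gapCVPVerifFn_apply (w : List Bool) :
    gapCVPVerifFn w = [!decide (bitsToNat (cLhsFn w) < bitsToNat (cRhsFn w))] := by
  rw [gapCVPVerifFn, notFn_apply (b := decide (bitsToNat (cLhsFn w) < bitsToNat (cRhsFn w)))]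
  simp [Function.comp_apply]

/-! ### The verifier's language -/

/-- The `P` language of accepted pairs `⟨x, y⟩`. [cite: AharonovRegev2005, §1 p. 2] -/
def gapCVPVerifLang : Language Bool := {w | gapCVPVerifFn w = [true]}

/-- **`gapCVPVerifLang ∈ P`.** [cite: AroraBarakCC2009, Def. 1.13 and §1.3] -/
theorem gapCVPVerifLang_mem_P : gapCVPVerifLang ∈ Classes.P :=
  mem_P_of_mem_FP gapCVPVerifFn_mem_FP _ fun w =>
    ⟨fun h => h, fun h => by
      obtain ⟨b, hb⟩ := oneBit_gapCVPVerifFn w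
      cases b
      · exact hb
      · exact absurd hb h⟩

/-! ### The value of the verifier on the code of an instance -/

section Decode

variable (I : LatticeInstance) (t : Fin I.n → ℤ) (d : ℚ) (y : List Bool)

/-- The integer `‖z B − t‖²` for the witness `z` denoted by `y` (`zOfWitness`). [folklore] -/
def distSqOfWitness : ℤ := ∑ j : Fin I.n, (Matrix.vecMul (zOfWitness I.n y) I.basis j - t j) ^ 2

/-- The list of entry codes of the target. [folklore] -/
def targetCodes : List (List Bool) := List.ofFn fun k : Fin I.n => encodingIntBool.encode (t k)

/-- The two list codes of the tree agree: `frames = body`. [folklore] -/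
private theorem frames_eq_body' (l : List (List Bool)) : frames l = body l := by
  rw [body, foldr_boolPair_eq (fun c : List Bool => c) l, List.map_id']

/-- The code of `((B, t), d)`, field by field, with the target framed as a list code. [folklore] -/
theorem encode_fields_cvp :
    gapCVPInstanceEncoding.encode ((⟨I, t⟩ : CVPInstance), d) =
      boolPair (boolPair (encodeNat I.n)
        (boolPair (boolPair (unaryEncodeNat (I.n * I.n)) (body (rowMajor I.n I.basis)))
          (boolPair (unaryEncodeNat I.n) (body (targetCodes I t)))))
        (boolPair (boolPair [decide (d.num < 0)] (encodeNat d.num.natAbs)) (encodeNat d.den)) := by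
  rw [FarCert.gapCVP_encode_fields, vec_encode_eq, frames_eq_body']
  rfl

variable {I t d y}

/-- The projections on the code of an instance paired with any string. [folklore] -/
theorem proj_encode_cvp (x : List Bool) (hx : x = gapCVPInstanceEncoding.encode ((⟨I, t⟩ : CVPInstance), d)) :
    vNcFn (boolPair x y) = encodeNat I.n ∧ cEntsBFn (boolPair x y) = body (rowMajor I.n I.basis) ∧
      cEntsTFn (boolPair x y) = body (targetCodes I t) ∧
      vNumFn (boolPair x y) = encodeNat d.num.natAbs ∧ vDenFn (boolPair x y) = encodeNat d.den := by
  subst hx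
  rw [encode_fields_cvp]
  simp [vNcFn, cEntsBFn, cEntsTFn, vNumFn, vDenFn, fstF, sndF]

/-- `n ≤ |x|` on the code of a `GapCVP` instance. [folklore] -/
theorem n_le_length_encode_cvp : I.n ≤ (gapCVPInstanceEncoding.encode ((⟨I, t⟩ : CVPInstance), d)).length :=
  (FarCert.sizes_le_length_encode_gapCVP I t d).1

/-- The target's entry list has `n` members. [folklore] -/
@[simp] theorem length_targetCodes : (targetCodes I t).length = I.n := by simp [targetCodes]

/-- Entries of the augmented list `[t; B]`, first block: `smval ([t; B][j]) = t j`. [folklore] -/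
theorem smval_elemOf_aug_fst (j : Fin I.n) :
    smval (elemOf (body (targetCodes I t ++ rowMajor I.n I.basis)) j) = t j := by
  have hj : (j : ℕ) < (targetCodes I t ++ rowMajor I.n I.basis).length := by
    simp [length_rowMajor]; omega
  rw [elemOf_body_of_lt _ hj, List.getElem_append_left (by simp)]
  simp [targetCodes]

/-- Entries of the augmented list `[t; B]`, second block: `smval ([t; B][(i+1) n + j]) = B i j`.
[folklore] -/
theorem smval_elemOf_aug_succ (i j : Fin I.n) :
    smval (elemOf (body (targetCodes I t ++ rowMajor I.n I.basis)) ((i + 1) * I.n + j)) = I.basis i j := by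
  have hlt : (i : ℕ) * I.n + j < (rowMajor I.n I.basis).length := by
    rw [length_rowMajor]; exact lt_of_lt_of_le (by omega) (jn_add_n_le I.n i)
  have hj : ((i : ℕ) + 1) * I.n + j < (targetCodes I t ++ rowMajor I.n I.basis).length := by
    rw [List.length_append, length_targetCodes, length_rowMajor] at *
    nlinarith
  rw [elemOf_body_of_lt _ hj, List.getElem_append_right (by simp; nlinarith)]
  have e : ((i : ℕ) + 1) * I.n + j - (targetCodes I t).length = i * I.n + j := by
    rw [length_targetCodes]; ring_nf; omega
  simp only [e]
  rw [getElem_rowMajor_entry I.basis i j hlt, smval_encode]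

/-- **The accumulator of the augmented loop is `z B − t`**, entry by entry. [folklore] -/
theorem ival_matAcc_aug (j : Fin I.n) :
    ival ((matAcc (body (targetCodes I t ++ rowMajor I.n I.basis)) (boolPair (dpEnc (-1)) y) I.n (I.n + 1)).getD j []) =
      Matrix.vecMul (zOfWitness I.n y) I.basis j - t j := by
  rw [ival_matAcc _ _ _ j.isLt, Finset.sum_range_succ', elemOf_zero, fstP_boolPair, ival_dpEnc, zero_mul, zero_add,
    smval_elemOf_aug_fst, Matrix.vecMul, dotProduct, Finset.sum_range (fun i => ival (elemOf (boolPair (dpEnc (-1)) y) (i + 1)) *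
      smval (elemOf (body (targetCodes I t ++ rowMajor I.n I.basis)) ((i + 1) * I.n + j)))]
  rw [sub_eq_add_neg, neg_one_mul]
  congr 1
  refine Finset.sum_congr rfl fun i _ => ?_
  rw [elemOf_succ, sndP_boolPair, smval_elemOf_aug_succ]
  rfl

/-- **The exact value of the verifier on the code of ANY instance paired with ANY string**:
accept iff `den(d)² ‖z B − t‖² ≤ num(d)²` for the witness `z` denoted by `y`.
[cite: AharonovRegev2005, §1 p. 2] -/
theorem gapCVPVerifFn_encode (I : LatticeInstance) (t : Fin I.n → ℤ) (d : ℚ) (y : List Bool) :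
    gapCVPVerifFn (boolPair (gapCVPInstanceEncoding.encode ((⟨I, t⟩ : CVPInstance), d)) y) =
      [decide ((d.den : ℤ) ^ 2 * distSqOfWitness I t y ≤ (d.num.natAbs : ℤ) ^ 2)] := by
  obtain ⟨hnc, hentsB, hentsT, hnum, hden⟩ :=
    proj_encode_cvp (y := y) (gapCVPInstanceEncoding.encode ((⟨I, t⟩ : CVPInstance), d)) rfl
  have hnx : I.n ≤ (gapCVPInstanceEncoding.encode ((⟨I, t⟩ : CVPInstance), d)).length := n_le_length_encode_cvp
  set w := boolPair (gapCVPInstanceEncoding.encode ((⟨I, t⟩ : CVPInstance), d)) y with hw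
  set ents := body (targetCodes I t ++ rowMajor I.n I.basis) with hents_def
  set zs := boolPair (dpEnc (-1)) y with hzs_def
  -- the unary dimension and the zero vector
  have hones : vOnesFn w = List.replicate I.n true := by
    simp only [vOnesFn, Function.comp_apply, fanoutFn_apply, hnc]
    rw [hw, show fstF (boolPair (gapCVPInstanceEncoding.encode ((⟨I, t⟩ : CVPInstance), d)) y) =
      gapCVPInstanceEncoding.encode ((⟨I, t⟩ : CVPInstance), d) by simp [fstF], binToUnaryFn_boolPair,
      bitsToNat_encodeNat, min_eq_left hnx]
  have hents : cEntsFn w = ents := by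
    rw [cEntsFn, hentsT, hentsB, hents_def, body_append]
  have hzs : cZsFn w = zs := by
    rw [cZsFn, fanoutFn_apply, hzs_def, hw]
    simp [sndF]
  have hcnt : cCntFn w = encodeNat (I.n + 1) := by
    simp only [cCntFn, Function.comp_apply, fanoutFn_apply, hnc, addFn_boolPair, bitsToNat_encodeNat]
  have hz2 : cZ2Fn w = boolPair (boolPair ents (boolPair zs (encodeNat I.n)))
      (boolPair (encodeNat (I.n + 1)) (boolPair [] (boolPair [] (body (List.replicate I.n []))))) := by
    simp only [cZ2Fn, fanoutFn_apply, Function.comp_apply, hones, zerosFn_apply, List.length_replicate, hnc, hents, hzs, hcnt]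
  have hnents : I.n ≤ ents.length := by
    rw [hents_def, body_append, List.length_append]
    exact (n_le_length_body_rowMajor I.n I.basis).trans (Nat.le_add_left _ _)
  have hm : I.n + 1 ≤ (boolPair ents (boolPair zs (encodeNat I.n))).length := by
    rw [length_boolPair, length_boolPair]; omega
  have hvec : cVecFn w = body (matAcc ents zs I.n (I.n + 1)) := by
    simp only [cVecFn, Function.comp_apply, hz2, matLoopFn_spec_rounds ents zs I.n (I.n + 1) hnents hm]
    simp [sndPow, sndF]
  set v := body (matAcc ents zs I.n (I.n + 1)) with hv
  have hnv : I.n ≤ v.length := by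
    rw [hv, length_body_eq]
    have h : ∀ l : List (List Bool), l.length ≤ (l.map fun a => 2 * a.length + 2).sum := by
      intro l; induction l with
      | nil => simp
      | cons a l ih => simp; omega
    have := h (matAcc ents zs I.n (I.n + 1))
    rwa [length_matAcc] at this
  have hS : cSFn w = sqAcc v I.n := by
    simp only [cSFn, Function.comp_apply, cZ3Fn, fanoutFn_apply, hvec, hnc]
    rw [sqLoopFn_spec v I.n hnv]
    simp [sndPow, sndF]
  -- the value of `S`
  have hSval : ival (sqAcc v I.n) = distSqOfWitness I t y := by
    rw [ival_sqAcc, distSqOfWitness, Finset.sum_range (fun k => ival (elemOf v k) ^ 2)]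
    refine Finset.sum_congr rfl fun j _ => ?_
    rw [hv, elemOf_body_of_lt _ (by rw [length_matAcc]; exact j.isLt), ← List.getD_eq_getElem _ [] _,
      hents_def, hzs_def, ival_matAcc_aug]
  -- the final comparison, with `N = |num d|`
  generalize hN : d.num.natAbs = N at hnum ⊢
  have hlhs : bitsToNat (cLhsFn w) = N ^ 2 + d.den ^ 2 * bitsToNat (sndF (sqAcc v I.n)) := by
    simp only [cLhsFn, vNum2Fn, vDen2Fn, Function.comp_apply, fanoutFn_apply, hS, addFn_boolPair, prodFn_boolPair,
      bitsToNat_encodeNat, hnum, hden, sq]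
  have hrhs : bitsToNat (cRhsFn w) = d.den ^ 2 * bitsToNat (fstF (sqAcc v I.n)) := by
    simp only [cRhsFn, vDen2Fn, Function.comp_apply, fanoutFn_apply, hS, prodFn_boolPair, bitsToNat_encodeNat, hden, sq]
  rw [gapCVPVerifFn_apply, hlhs, hrhs]
  have hPQ : (bitsToNat (fstF (sqAcc v I.n)) : ℤ) - bitsToNat (sndF (sqAcc v I.n)) = distSqOfWitness I t y := by
    rw [← hSval]; rfl
  generalize bitsToNat (fstF (sqAcc v I.n)) = P at hPQ ⊢
  generalize bitsToNat (sndF (sqAcc v I.n)) = Q at hPQ ⊢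
  generalize distSqOfWitness I t y = S at hPQ ⊢
  have key : (N ^ 2 + d.den ^ 2 * Q < d.den ^ 2 * P) ↔ ¬ ((d.den : ℤ) ^ 2 * S ≤ (N : ℤ) ^ 2) := by
    rw [not_le, ← hPQ, mul_sub]
    constructor
    · intro h
      have h' := (Nat.cast_lt (α := ℤ)).2 h
      push_cast at h'
      linarith
    · intro h
      have h' : ((N ^ 2 + d.den ^ 2 * Q : ℕ) : ℤ) < ((d.den ^ 2 * P : ℕ) : ℤ) := by push_cast; linarith
      exact_mod_cast h'
  by_cases hle : (d.den : ℤ) ^ 2 * S ≤ (N : ℤ) ^ 2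
  · have hlt : ¬ (N ^ 2 + d.den ^ 2 * Q < d.den ^ 2 * P) := fun h => (key.1 h) hle
    simp [hle, hlt]
  · have hlt : N ^ 2 + d.den ^ 2 * Q < d.den ^ 2 * P := key.2 hle
    simp [hle, hlt]

end Decode

/-! ### Soundness: NO instances have no accepted witness -/

/-- The decoded witness names the lattice vector `z B`, at squared distance `distSqOfWitness`
from the target. [folklore] -/
theorem dist_sq_ofCoeffs_zOfWitness (I : LatticeInstance) (t : Fin I.n → ℤ) (y : List Bool) :
    dist (intVecToEuclidean I.n t) (I.ofCoeffs (zOfWitness I.n y)) ^ 2 = (distSqOfWitness I t y : ℝ) := by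
  rw [dist_comm, dist_eq_norm, LatticeInstance.ofCoeffs, ← map_sub, norm_sq_intVecToEuclidean, distSqOfWitness]
  push_cast
  exact Finset.sum_congr rfl fun j _ => by simp [Pi.sub_apply]

/-- From `den(d)² D ≤ |num(d)|²` for the squared distance `D = δ²` (`δ ≥ 0`) to `δ ≤ |d|`. [folklore] -/
theorem le_abs_of_den_sq_mul_le {d : ℚ} {δ : ℝ} (hδ : 0 ≤ δ) {D : ℤ} (hD : δ ^ 2 = (D : ℝ))
    (h : (d.den : ℤ) ^ 2 * D ≤ (d.num.natAbs : ℤ) ^ 2) : δ ≤ |(d : ℝ)| := by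
  have hden : (0 : ℝ) < d.den := by exact_mod_cast d.den_pos
  have hd' : |(d : ℝ)| = |(d.num : ℝ)| / d.den := by
    have e : (d : ℝ) = d.num / d.den := by exact_mod_cast (Rat.num_div_den d).symm
    rw [e, abs_div, abs_of_pos hden]
  have h' : (d.den : ℝ) ^ 2 * (D : ℝ) ≤ |(d.num : ℝ)| ^ 2 := by
    have h1 : (((d.den : ℤ) ^ 2 * D : ℤ) : ℝ) ≤ (((d.num.natAbs : ℤ) ^ 2 : ℤ) : ℝ) := by exact_mod_cast h
    push_cast at h1
    simpa using h1
  rw [hd', le_div_iff₀ hden]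
  have hsq : (δ * d.den) ^ 2 ≤ |(d.num : ℝ)| ^ 2 := by rw [mul_pow, hD]; linarith
  exact (pow_le_pow_iff_left₀ (by positivity) (abs_nonneg _) two_ne_zero).1 hsq

/-- **Soundness**: on the code of a NO instance of `GapCVP_γ` with `γ(n) ≥ 1`, no string is
accepted (the decoded `z B` would be a lattice vector at distance `≤ d ≤ γ(n) d < dist(t, L(B))`
from `t`). [cite: AharonovRegev2005, §1 p. 2] -/
theorem not_mem_gapCVPVerifLang_of_no {γ : ℕ → ℝ} {I : LatticeInstance} {t : Fin I.n → ℤ} {d : ℚ} (hγ : 1 ≤ γ I.n)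
    (h : ((⟨I, t⟩ : CVPInstance), d) ∈ GapCVP.no γ) (y : List Bool) :
    boolPair (gapCVPInstanceEncoding.encode ((⟨I, t⟩ : CVPInstance), d)) y ∉ gapCVPVerifLang := by
  intro hacc
  change gapCVPVerifFn _ = [true] at hacc
  rw [gapCVPVerifFn_encode] at hacc
  have hdec : (d.den : ℤ) ^ 2 * distSqOfWitness I t y ≤ (d.num.natAbs : ℤ) ^ 2 :=
    of_decide_eq_true (List.cons.inj hacc).1
  obtain ⟨-, hd, hlt⟩ := h
  change γ I.n * (d : ℝ) < infDist (intVecToEuclidean I.n t) (I.lattice : Set (EuclideanSpace ℝ (Fin I.n))) at hlt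
  have hdpos : (0 : ℝ) < d := by exact_mod_cast hd
  have hle : infDist (intVecToEuclidean I.n t) (I.lattice : Set (EuclideanSpace ℝ (Fin I.n))) ≤
      dist (intVecToEuclidean I.n t) (I.ofCoeffs (zOfWitness I.n y)) :=
    infDist_le_dist_of_mem (I.ofCoeffs_mem_lattice _)
  have hud : dist (intVecToEuclidean I.n t) (I.ofCoeffs (zOfWitness I.n y)) ≤ |(d : ℝ)| :=
    le_abs_of_den_sq_mul_le dist_nonneg (dist_sq_ofCoeffs_zOfWitness I t y) hdec
  rw [abs_of_pos hdpos] at hud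
  have : γ I.n * (d : ℝ) < γ I.n * d := by
    calc γ I.n * (d : ℝ) < _ := hlt
      _ ≤ _ := hle
      _ ≤ d := hud
      _ ≤ γ I.n * d := le_mul_of_one_le_left hdpos.le hγ
  exact lt_irrefl _ this

/-! ### Completeness: YES instances have a short accepted witness -/

/-- Sizes of the target's entries against the code length: `size |tₖ| ≤ |x|`. [cite: MicciancioGoldwasser2002, Ch. 1 §1.3 (size of the input)] -/
theorem size_target_le_length_encode (I : LatticeInstance) (t : Fin I.n → ℤ) (d : ℚ) (k : Fin I.n) :
    (t k).natAbs.size ≤ (gapCVPInstanceEncoding.encode ((⟨I, t⟩ : CVPInstance), d)).length := by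
  have hmem : encodingIntBool.encode (t k) ∈ targetCodes I t := by
    simp only [targetCodes, List.mem_ofFn]; exact ⟨k, rfl⟩
  have hlen := length_le_length_body hmem
  rw [length_encodingIntBool_encode, TM2Pass.length_encodeNat_eq_size] at hlen
  have hsplit : (body (targetCodes I t)).length ≤ (gapCVPInstanceEncoding.encode ((⟨I, t⟩ : CVPInstance), d)).length := by
    rw [encode_fields_cvp]
    simp only [length_boolPair]
    omega
  omega

/-- **Size of the coefficients of a closest vector** (Cramer's rule with Hadamard's bound): if
`n`, `size n`, the sizes of the entries of the nonsingular `B` and of `t` are at most `L`, and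
`‖z B‖² ≤ 4 ‖t‖²`, then `size |zᵢ| ≤ 3 L² + 3 L + 2` (`|(z B)ⱼ| ≤ 2 n 2ᴸ =: K ≥ |Bₐᵦ|`,
`|zᵢ| ≤ n! Kⁿ`). [cite: MicciancioGoldwasser2002, Ch. 1 §1.3] -/
theorem size_coeff_le_of_norm_sq_le {I : LatticeInstance} (hI : I.IsNonsingular) {t z : Fin I.n → ℤ} {L : ℕ}
    (hnL : I.n ≤ L) (hsn : I.n.size ≤ L) (hsB : ∀ a b, (I.basis a b).natAbs.size ≤ L)
    (hst : ∀ k, (t k).natAbs.size ≤ L) (hsum : ∑ k, Matrix.vecMul z I.basis k ^ 2 ≤ 4 * ∑ k, t k ^ 2) (i : Fin I.n) :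
    (z i).natAbs.size ≤ 3 * L ^ 2 + 3 * L + 2 := by
  set u : Fin I.n → ℤ := Matrix.vecMul z I.basis with hu
  set W : ℕ := 2 ^ L with hW
  have hBW : ∀ a b, (I.basis a b).natAbs < W := fun a b => Nat.size_le.1 (hsB a b)
  have htW : ∀ k, (t k).natAbs < W := fun k => Nat.size_le.1 (hst k)
  have htsq : ∑ k, t k ^ 2 ≤ (I.n : ℤ) * (W : ℤ) ^ 2 := by
    calc ∑ k, t k ^ 2 ≤ ∑ _k : Fin I.n, (W : ℤ) ^ 2 := Finset.sum_le_sum fun k _ => by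
          have h1 : |t k| ≤ (W : ℤ) := by rw [Int.abs_eq_natAbs]; exact_mod_cast (htW k).le
          nlinarith [abs_nonneg (t k), sq_abs (t k)]
      _ = (I.n : ℤ) * (W : ℤ) ^ 2 := by simp
  set K : ℕ := 2 * I.n * W with hK
  have hul : ∀ l, (u l).natAbs ≤ K := by
    intro l
    have h1 := sq_apply_le_sum_sq u l
    have hn1 : (1 : ℤ) ≤ I.n := by exact_mod_cast Nat.succ_le_of_lt (Fin.pos l)
    have hW0 : (0 : ℤ) ≤ W := by positivity
    have h5 : u l * u l ≤ ((K : ℕ) : ℤ) * ((K : ℕ) : ℤ) := by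
      have e : ((K : ℕ) : ℤ) * ((K : ℕ) : ℤ) = 4 * ((I.n : ℤ) * I.n) * (W : ℤ) ^ 2 := by rw [hK]; push_cast; ring
      rw [e]
      have h7 : (I.n : ℤ) * (W : ℤ) ^ 2 ≤ (I.n : ℤ) * I.n * (W : ℤ) ^ 2 := by
        have : (I.n : ℤ) ≤ (I.n : ℤ) * I.n := by nlinarith
        exact mul_le_mul_of_nonneg_right this (by positivity)
      nlinarith [h1, hsum, htsq, h7]
    have h6 := Int.natAbs_le_iff_mul_self_le.2 h5
    rwa [Int.natAbs_natCast] at h6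
  have hKB : ∀ a b, (I.basis a b).natAbs ≤ K := fun a b => by
    have hn1 : 1 ≤ I.n := Nat.succ_le_of_lt (Fin.pos a)
    calc (I.basis a b).natAbs ≤ W := (hBW a b).le
      _ ≤ K := by rw [hK]; nlinarith
  have hzi : (z i).natAbs ≤ (I.n).factorial * K ^ I.n := natAbs_coeff_le hI rfl hKB hul i
  -- sizes against `L`
  have hsW : W.size = L + 1 := by rw [hW, Nat.size_pow]
  have hsK : K.size ≤ 2 * L + 3 := by
    rw [hK]
    refine (size_mul_le _ _).trans ?_
    have h2 : (2 * I.n).size ≤ (2 : ℕ).size + I.n.size := size_mul_le 2 I.n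
    have h22 : (2 : ℕ).size = 2 := by decide
    omega
  refine (Nat.size_le_size hzi).trans ((size_mul_le _ _).trans ?_)
  have h1 := size_factorial_le I.n
  have h2 : (K ^ I.n).size ≤ I.n * K.size + 1 := size_pow_le _ _
  have h3 : I.n * (I.n).size ≤ L * L := Nat.mul_le_mul hnL hsn
  have h4 : I.n * K.size ≤ L * (2 * L + 3) := Nat.mul_le_mul hnL hsK
  have e2 : L ^ 2 = L * L := sq _
  rw [e2]
  nlinarith

/-- **Completeness**: the code of a YES instance of `GapCVP_γ` has an accepted witness of length
`≤ 24 (|x| + 1)³` — the canonical witness of the coefficient vector of a closest lattice vector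
`u` (which satisfies `‖u‖ ≤ 2‖t‖`, compare with `0 ∈ L(B)`; then `size_coeff_le_of_norm_sq_le`).
[cite: AharonovRegev2005, §1 p. 2; MicciancioGoldwasser2002 Ch. 1 §1.3] -/
theorem exists_short_witness_of_yes_cvp {γ : ℕ → ℝ} {I : LatticeInstance} {t : Fin I.n → ℤ} {d : ℚ}
    (h : ((⟨I, t⟩ : CVPInstance), d) ∈ GapCVP.yes γ) :
    ∃ y : List Bool, y.length ≤ 24 * ((gapCVPInstanceEncoding.encode ((⟨I, t⟩ : CVPInstance), d)).length + 1) ^ 3 ∧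
      boolPair (gapCVPInstanceEncoding.encode ((⟨I, t⟩ : CVPInstance), d)) y ∈ gapCVPVerifLang := by
  obtain ⟨hI, hd, hle⟩ := h
  change infDist (intVecToEuclidean I.n t) (I.lattice : Set (EuclideanSpace ℝ (Fin I.n))) ≤ (d : ℝ) at hle
  -- a closest lattice vector `u = z B`
  have hclosed : IsClosed (X := EuclideanSpace ℝ (Fin I.n)) I.lattice :=
    @AddSubgroup.isClosed_of_discrete _ _ _ _ _ I.lattice.toAddSubgroup
      (inferInstanceAs (DiscreteTopology I.lattice))
  obtain ⟨w, hwL, hw⟩ := hclosed.exists_infDist_eq_dist ⟨0, I.lattice.zero_mem⟩ (intVecToEuclidean I.n t)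
  obtain ⟨z, rfl⟩ := (I.mem_lattice_iff w).1 hwL
  have huE : I.ofCoeffs z = intVecToEuclidean I.n (Matrix.vecMul z I.basis) := rfl
  refine ⟨witnessOf z, ?_, ?_⟩
  · -- size of the witness
    obtain ⟨hnL, hsn, hsB, -, -⟩ := FarCert.sizes_le_length_encode_gapCVP I t d
    -- `‖u‖ ≤ 2 ‖t‖`, hence `∑ uₖ² ≤ 4 ∑ tₖ²`
    have hdist0 : dist (intVecToEuclidean I.n t) (I.ofCoeffs z) ≤ ‖intVecToEuclidean I.n t‖ := by
      rw [← hw]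
      have h0 := infDist_le_dist_of_mem (x := intVecToEuclidean I.n t) I.lattice.zero_mem
      rwa [dist_zero_right] at h0
    have hnorm : ‖intVecToEuclidean I.n (Matrix.vecMul z I.basis)‖ ≤ 2 * ‖intVecToEuclidean I.n t‖ := by
      rw [← huE]
      calc ‖I.ofCoeffs z‖ = ‖(I.ofCoeffs z - intVecToEuclidean I.n t) + intVecToEuclidean I.n t‖ := by rw [sub_add_cancel]
        _ ≤ ‖I.ofCoeffs z - intVecToEuclidean I.n t‖ + ‖intVecToEuclidean I.n t‖ := norm_add_le _ _
        _ = dist (intVecToEuclidean I.n t) (I.ofCoeffs z) + ‖intVecToEuclidean I.n t‖ := by rw [dist_comm, dist_eq_norm]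
        _ ≤ 2 * ‖intVecToEuclidean I.n t‖ := by linarith
    have hsum : ∑ k, Matrix.vecMul z I.basis k ^ 2 ≤ 4 * ∑ k, t k ^ 2 := by
      have h2 : ((∑ k, Matrix.vecMul z I.basis k ^ 2 : ℤ) : ℝ) ≤ 4 * ((∑ k, t k ^ 2 : ℤ) : ℝ) := by
        rw [← norm_sq_intVecToEuclidean, ← norm_sq_intVecToEuclidean]
        nlinarith [norm_nonneg (intVecToEuclidean I.n (Matrix.vecMul z I.basis)), norm_nonneg (intVecToEuclidean I.n t)]
      exact_mod_cast h2
    have hs : ∀ i, (z i).natAbs.size ≤ 3 * (gapCVPInstanceEncoding.encode ((⟨I, t⟩ : CVPInstance), d)).length ^ 2 +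
        3 * (gapCVPInstanceEncoding.encode ((⟨I, t⟩ : CVPInstance), d)).length + 2 :=
      size_coeff_le_of_norm_sq_le hI hnL hsn hsB (size_target_le_length_encode I t d) hsum
    refine (length_witnessOf_le z hs).trans ?_
    generalize (gapCVPInstanceEncoding.encode ((⟨I, t⟩ : CVPInstance), d)).length = L at hnL ⊢
    have h1 : I.n * (6 * (3 * L ^ 2 + 3 * L + 2) + 6) ≤ L * (6 * (3 * L ^ 2 + 3 * L + 2) + 6) :=
      Nat.mul_le_mul_right _ hnL
    have e1 : L * (6 * (3 * L ^ 2 + 3 * L + 2) + 6) = 18 * L ^ 3 + 18 * L ^ 2 + 18 * L := by ring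
    have e2 : 24 * (L + 1) ^ 3 = 24 * L ^ 3 + 72 * L ^ 2 + 72 * L + 24 := by ring
    rw [e1] at h1
    rw [e2]
    omega
  · -- acceptance: `den² ‖u − t‖² ≤ num²` from `‖u − t‖ = dist(t, L(B)) ≤ d`
    change gapCVPVerifFn _ = [true]
    rw [gapCVPVerifFn_encode]
    refine congrArg (fun b => [b]) (decide_eq_true ?_)
    have hD : dist (intVecToEuclidean I.n t) (I.ofCoeffs z) ^ 2 = (distSqOfWitness I t (witnessOf z) : ℝ) := by
      rw [← dist_sq_ofCoeffs_zOfWitness I t (witnessOf z), zOfWitness_witnessOf]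
    have hud : dist (intVecToEuclidean I.n t) (I.ofCoeffs z) ≤ d := by rw [← hw]; exact hle
    have hnum : (d.num.natAbs : ℤ) = d.num := Int.natAbs_of_nonneg (Rat.num_nonneg.2 hd.le)
    rw [hnum]
    have hd' : (d : ℝ) = d.num / d.den := by exact_mod_cast (Rat.num_div_den d).symm
    have hden : (0 : ℝ) < d.den := by exact_mod_cast d.den_pos
    have h1 : dist (intVecToEuclidean I.n t) (I.ofCoeffs z) * d.den ≤ d.num := by
      rw [hd', le_div_iff₀ hden] at hud; exact hud
    have h2 : (dist (intVecToEuclidean I.n t) (I.ofCoeffs z) * d.den) ^ 2 ≤ (d.num : ℝ) ^ 2 :=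
      pow_le_pow_left₀ (by positivity) h1 2
    rw [mul_pow, hD] at h2
    have h3 : ((d.den : ℤ) : ℝ) ^ 2 * ((distSqOfWitness I t (witnessOf z) : ℤ) : ℝ) ≤ ((d.num : ℤ) : ℝ) ^ 2 := by
      have : ((d.den : ℤ) : ℝ) = (d.den : ℝ) := by norm_cast
      rw [this]; linarith
    exact_mod_cast h3

/-! ### The `NP` language and the discharge -/

/-- **The `NP` language separating `GapCVP_γ`** (`γ ≥ 1`): strings with an accepted witness of
length `≤ 24 (|x| + 1)³` (the witness-length polynomial `gapSVPWitnessPoly` of the `GapSVP` file).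
[cite: AharonovRegev2005, §1 p. 2] -/
def gapCVPNPLang : Language Bool :=
  {x | ∃ y : List Bool, y.length ≤ gapSVPWitnessPoly.eval x.length ∧ boolPair x y ∈ gapCVPVerifLang}

/-- **`gapCVPNPLang ∈ NP`** (certificate form over the `P` verifier; `NP = ∃ᵖ P` by definition).
[cite: AroraBarakCC2009, Def. 2.1] -/
theorem gapCVPNPLang_mem_NP : gapCVPNPLang ∈ Nondeterministic.NP :=
  ⟨gapCVPVerifLang, gapCVPVerifLang_mem_P, gapSVPWitnessPoly, fun _ => Iff.rfl⟩

/-- **`GapCVP_γ ∈ PromiseNP` for every factor `γ ≥ 1`** (`gapCVP_mem_promiseNP`, DISCHARGED):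
the `NP` language `gapCVPNPLang` contains the code of every YES instance (the canonical witness of
the coefficients of a closest lattice vector, `exists_short_witness_of_yes_cvp`) and of no NO
instance (soundness of the verifier, `not_mem_gapCVPVerifLang_of_no`).
[cite: AharonovRegev2005, §1 p. 2 ("containment in NP is trivial") and Thm. 1.1] -/
theorem gapCVP_mem_promiseNP_holds : gapCVP_mem_promiseNP := by
  intro γ hγ
  refine ⟨gapCVPNPLang, gapCVPNPLang_mem_NP, ?_, ?_⟩
  · rintro x hx
    rw [gapCVPPromise_yes] at hx
    obtain ⟨⟨⟨I, t⟩, d⟩, hp, rfl⟩ := hx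
    obtain ⟨y, hy, hacc⟩ := exists_short_witness_of_yes_cvp hp
    exact ⟨y, by rwa [gapSVPWitnessPoly_eval], hacc⟩
  · rintro x hx
    rw [gapCVPPromise_no] at hx
    obtain ⟨⟨⟨I, t⟩, d⟩, hp, rfl⟩ := hx
    rintro ⟨y, -, hacc⟩
    exact not_mem_gapCVPVerifLang_of_no (hγ I.n) hp y hacc

/-- **Both halves of Aharonov–Regev 2005 (Cor. 1.2 for `GapSVP`, Thm. 1.1 for `GapCVP`) from the
coNP part of Thm. 1.1 alone**: with the NP leaves (`gapSVP_mem_promiseNP_holds`,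
`gapCVP_mem_promiseNP_holds`) and Lemma A.1 discharged, the conjunction vendored as
`Literature.Barriers.PneNP.LatticeGapCoNP` follows from `gapCVP_sqrt_mem_promiseCoNP`.
[cite: AharonovRegev2005, Thm. 1.1 and Cor. 1.2 (p. 2)] -/
theorem gapSVP_and_gapCVP_sqrt_mem_of_coNP_part (h11 : gapCVP_sqrt_mem_promiseCoNP) :
    gapSVP_sqrt_mem_promiseNP_inter_promiseCoNP ∧ gapCVP_sqrt_mem_promiseNP_inter_promiseCoNP :=
  gapSVP_and_gapCVP_sqrt_mem_of gapCVP_mem_promiseNP_holds h11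

/-- **The conjunction from the two remaining named facts** of the integer coNP certificate
(`GapCVPCoNPSample.lean`): the TM2 verifier machine `FarCert.verifier_mem_P` and the exact PSD
certificates of polynomial size `FarCert.psd_cert_exists`.
[cite: AharonovRegev2005, Thm. 1.1 and Cor. 1.2 (p. 2), §6] -/
theorem gapSVP_and_gapCVP_sqrt_mem_of_psd (hV : FarCert.verifier_mem_P) (h2 : FarCert.psd_cert_exists) :
    gapSVP_sqrt_mem_promiseNP_inter_promiseCoNP ∧ gapCVP_sqrt_mem_promiseNP_inter_promiseCoNP :=
  gapSVP_and_gapCVP_sqrt_mem_of_coNP_part (gapCVP_sqrt_mem_promiseCoNP_of_psd hV h2)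

end Literature.Algebra.EuclideanLattices

end
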